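import Summits.MatrixMultiplication.MatrixMultiplication.Theorems.DesignFlatteningWeylSeparableFloor

/-!
# MatrixMultiplication / DesignFlattening — `GrowingHostDesigns`, line `birth`: the hexagon floor of the canonical family

Route `DesignFlattening`, crux `GrowingHostDesigns` (stmt-MatrixMultiplication-8033), line `birth`
(tight square host `G_m = ℤ_m × ℤ_m`, kept set `P_m = {(b,c) | b₂ + c₁ = 0}`).  The line's open stub
`stub_canonicalSeparableRate` asks for separable `k`-term toric designs of the `N`-th power of the
punctured table `T_m = [b + c = a ∧ b₂ + c₁ = 0]` with `m^{2N} · k < (m^{2+δ})^N`, i.e. `k < m^{δN}`.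

This file proves the uniform HEXAGON FLOOR of the canonical family: for every `m ≥ 2`, every `N` and
every separable `k`-term toric design of `T_m^{⊗N}` one has `(3/2)^N ≤ k`.  Hence a witness of the
stub at level `δ` needs `m^δ > 3/2`, i.e. `m > (3/2)^{1/δ}` — no fixed `m` serves all `δ`, and at
`m = 2` nothing below `k ≥ (3/2)^N` (exponent `2 + log₂(3/2) = 2.585`) is certifiable by separable designs.

Proof: ONE hexagon move of the toric ideal of the table of `ℤ_m²`, uniform in `m ≥ 2` — in
`(b; c)`-coordinates `A = {(00;00), (01;−1,−1), (11;−1,0)} ⊆ P_m` and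
`B = {(00;−1,0), (01;00), (11;−1,−1)}` with `B₁, B₂ ∉ P_m` (`−1 ≠ 0`, `1 ≠ 0` in `ZMod m`, `m ≥ 2`):
the `b`-, `c`- and `(b+c)`-marginals of `A` and `B` agree (`b + c ∈ {(0,0), (−1,0), (0,1)}` on both),
so the signed selection `L = ((x_{A₁}, x_{B₁}, 0), (0, x_{A₂}, x_{B₂}), (−x_{B₃}, 0, x_{A₃}))` has
`det L = x^A − x^B`, which vanishes at every toric point `u(b+c) v(b) w(c)` (rank `≤ 2`), while
`L(T_m) = ((1,0,0),(0,1,0),(−1,0,1))` is invertible; `three_pow_le_of_design` (the abstract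
design-flattening bound of `DesignFlatteningWeylSeparableFloor`) gives `3^N ≤ k · 2^N`.

Sources: Coppersmith–Winograd 1990 §11 (toric designs); Landsberg 2017 (GCT book) §X-rank
flattenings; the route's supports `SeparableTorusFloor`, `WeylSeparableFloor` (same mechanism).
-/

-- the tree's namespace `Summit.MatrixMultiplication.MatrixMultiplication.…` repeats a component by design
set_option linter.dupNamespace false

namespace Summit.MatrixMultiplication.MatrixMultiplication.Theorems

open scoped BigOperators
open Literature.Computability.AlgebraicComplexity
open DesignFlatteningWeylSeparableFloor

/-- **Hexagon floor of the canonical family** (crux `GrowingHostDesigns`, line `birth`, against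
`stub_canonicalSeparableRate`): for `m ≥ 2`, every separable `k`-term toric design
`T_m^{⊗N}(a;b,c) = ∑ⱼ ∏ᵢ [bᵢ + cᵢ = aᵢ] · u_{ji}(aᵢ) v_{ji}(bᵢ) w_{ji}(cᵢ)` of the `N`-th power of the
punctured table `T_m = [b + c = a ∧ b₂ + c₁ = 0]` over `ℤ_m × ℤ_m` has `(3/2)^N ≤ k`.  One uniform
hexagon move `A = {(00;00),(01;−1,−1),(11;−1,0)}`, `B = {(00;−1,0),(01;00),(11;−1,−1)}`:
`det L = x^A − x^B` kills toric points, `L(T_m)` is unipotent. -/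
theorem canonicalHexagonFloor (m : ℕ) [NeZero m] (hm : 2 ≤ m) (N k : ℕ)
    (u v w : Fin k → Fin N → ZMod m × ZMod m → ℂ)
    (h : ∀ a b c : Fin N → ZMod m × ZMod m,
      kroneckerPow (fun a b c : ZMod m × ZMod m =>
          if b + c = a ∧ (b, c) ∈
              (Finset.univ.filter fun bc : (ZMod m × ZMod m) × (ZMod m × ZMod m) =>
                bc.1.2 + bc.2.1 = 0)
          then (1 : ℂ) else 0) N a b c =
        ∑ j, ∏ i, ((if b i + c i = a i then (1 : ℂ) else 0) *
          u j i (a i) * v j i (b i) * w j i (c i))) :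
    ((3 : ℝ) / 2) ^ N ≤ (k : ℝ) := by
  haveI : Fact (1 < m) := ⟨hm⟩
  -- reduce to the integer inequality `3^N ≤ k · 2^N`
  suffices hk : 3 ^ N ≤ k * 2 ^ N by
    rw [div_pow, div_le_iff₀ (by positivity)]
    exact_mod_cast hk
  have h1 : (1 : ZMod m) ≠ 0 := one_ne_zero
  have hn1 : (-1 : ZMod m) ≠ 0 := neg_ne_zero.mpr one_ne_zero
  -- cells `(b, c)` of the table (`a = b + c` is forced); the selection `e` and the signs `σ`
  refine three_pow_le_of_design (ι := (ZMod m × ZMod m) × (ZMod m × ZMod m))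
    ![![((0, 0), (0, 0)), ((0, 0), (-1, 0)), ((0, 0), (0, 0))],
      ![((0, 0), (0, 0)), ((0, 1), (-1, -1)), ((0, 1), (0, 0))],
      ![((1, 1), (-1, -1)), ((0, 0), (0, 0)), ((1, 1), (-1, 0))]]
    ![![1, 1, 0], ![0, 1, 1], ![-1, 0, 1]]
    (fun bc => if bc.1.2 + bc.2.1 = 0 then (1 : ℂ) else 0)
    (fun j i bc => u j i (bc.1 + bc.2) * v j i bc.1 * w j i bc.2) ?_ ?_ ?_
  · -- the design identity on the table
    intro x
    have hx := h (fun i => (x i).1 + (x i).2) (fun i => (x i).1) (fun i => (x i).2)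
    simpa using hx
  · -- `L(T)` is invertible: `L(T) = ((1,0,0),(0,1,0),(-1,0,1))`, `det = 1`
    rw [Matrix.isUnit_iff_isUnit_det, isUnit_iff_ne_zero]
    rw [Matrix.det_fin_three]
    simp [h1, hn1]
  · -- `L(t)` is singular at toric points: `det = x^A - x^B = 0`
    intro j i
    apply rank_le_two_of_det_eq_zero
    rw [Matrix.det_fin_three]
    simp only [Matrix.cons_val', Matrix.cons_val_fin_one, Fin.isValue, Matrix.of_apply,
      Matrix.cons_val_zero, Prod.mk_add_mk, zero_add, add_zero, one_mul, Matrix.cons_val_one,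
      Matrix.cons_val, zero_mul, mul_zero, sub_zero, neg_mul, mul_neg, neg_zero, add_neg_cancel]
    ring

end Summit.MatrixMultiplication.MatrixMultiplication.Theorems
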